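/-
Copyright: H21 K2-LIT squad (hodgecm-mathlib). Helper for crux hLiu418 = `stmt-HodgeConjecture-24832`
(route `route-HodgeConjecture-HCCMUnconditional`), G-road (G1 ★ `K2LiuContinuationLieDerivative`, G2-PS of SIGS-RoadI-v3 §G1.1).
-/
import Summits.HodgeConjecture.HodgeConjecture.Theorems.K2LiuArchOneParameterOrbitDefs    -- ★ `archExp` (the orbit `γ_X`) and its one-parameter law
import Literature.NumberTheory.K2Lit.SiegelStandardExtension                              -- ★ `stdExtension`, `IwasawaDatum.pPart`, `IsDeltaUnimodular`
import Mathlib.Analysis.SpecialFunctions.Pow.Deriv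
import Mathlib.Analysis.Complex.RealDeriv
import Mathlib.Analysis.Calculus.Deriv.Shift
import Mathlib.RingTheory.Finiteness.Subalgebra
import HarnessLib

/-!
# The Lie derivative of a STANDARD (flat) extension along an archimedean one-parameter orbit

For an Iwasawa datum `𝒦` of `H(𝔸) = U(𝕍 ⊕ −𝕍)(𝔸)` (★ `K2Lit.SiegelDoubled.IwasawaDatum`, unimodular along `Δ` — free for every datum by
★ `K2LiuIwasawaDeltaUnimodular`), the standard extension of `φ : H(𝔸) → ℂ` from `s₀` is
★ `stdExtension 𝒦 s₀ φ s h = (Φ_𝒦 h : ℂ)^(2(s − s₀)) · φ h` with the **Iwasawa height** `Φ_𝒦 h := modDelta (𝒦.pPart h) = |det_Δ p_h|^{1/2}`.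
Along the orbit `t ↦ h · γ_X(t)`, `γ_X t = archExp … hX t = ι_∞(exp tX)` (★ `K2LiuArchOneParameterOrbitDefs`, `X ∈ 𝔥_∞ = archSkew`), its
`t`-derivative is a product rule with TWO infinitesimal inputs, both taken BY VALUE here:

* `hXφ : ∀ h, HasDerivAt (fun t => φ (h * γ_X t)) (Xφ h) 0` — the right Lie derivative `X·φ` (for Siegel–Weil data: G2-Weil);
* `hH  : ∀ h, HasDerivAt (fun t => Φ_𝒦 (h * γ_X t)) (Φ_𝒦 h * H h) 0` — the logarithmic derivative `H = H_X` of the Iwasawa height along the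
  orbit (a property of the archimedean component of `K`; explicit for STANDARD data, ★ `IwasawaDatum.IsStd` — discharged elsewhere).

Results (all places at once, no measure theory):
1. `hasDerivAt_orbit_of_forall_zero` — a derivative known at `t = 0` for EVERY base point propagates to every `t` (one-parameter law
   ★ `archExp_add_comm`);
2. `heightDeriv_delta_mul` — `H (p h) = H h` for `p ∈ P_Δ(𝔸)` (★ `modDelta_pPart_delta_mul` + uniqueness of derivatives);
3. `isSiegelDeltaSection_lieDeriv`, `isSiegelDeltaSection_heightDeriv_mul` — `X·φ` and `H·φ` lie in `I(s₀, χ)` when `φ` does;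
4. `IsKFinite.mul` — products of `K`-finite functions are `K`-finite (Mathlib `Submodule.FG.mul`);
5. **`hasDerivAt_stdExtension_orbit`** — for every `s h t₀`,
   `d/dt|_{t₀} stdExt(φ)_s(h γ_X t) = stdExt(X·φ)_s(h γ_X t₀) + 2(s − s₀) · stdExt(H·φ)_s(h γ_X t₀)`;
6. `isStandardSectionFamily_lieDeriv`, `isStandardSectionFamily_heightDeriv_mul` — both output families are STANDARD
   (★ `isStandardSectionFamily_stdExtension`), so (5) is the «flat-vs-translate identity» `X·(stdExt φ) = Σᵢ cᵢ(s) • stdExt φᵢ` of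
   SIGS-RoadI-v3 §G1.1 with `(φ₁, c₁) = (X·φ, 1)`, `(φ₂, c₂) = (H·φ, 2(s − s₀))` — finitely many standard families with polynomial coefficients.

[cite: KudlaRallis1994, §1 (standard sections `Φ(s) = Φ |a(g)|^{s−s₀}`, `I(s,χ)` as a `(𝔤, K_∞) × G(𝔸_f)`-module)]
[cite: Tan1999, §1 p. 166] [cite: HarrisKudlaSweet1996, (1.15)–(1.17)] [cite: Knapp2002, 0.§2 Prop. 0.11 (one-parameter subgroups)]
-/

set_option linter.dupNamespace false -- the mandated namespace repeats `HodgeConjecture.HodgeConjecture`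

open Literature.NumberTheory.Automorphic.UnitaryGroup
open Literature.NumberTheory.GaloisRepresentations
open Literature.NumberTheory.GelbartRogawski1991 Literature.NumberTheory.GelbartRogawski1991.GRConstruction
open Literature.NumberTheory.K2Lit.SiegelDoubled
-- `Classical` is needed to see the Mathlib normed-ring instances on `mixedSpace L` (note H5 of `AdelicGLnGlue`)
open scoped Classical
open NumberField NumberField.mixedEmbedding IsDedekindDomain Complex
open scoped Topology

namespace Summit.HodgeConjecture.HodgeConjecture.Cruxes.HLiu418.K2LiuFlatSectionLieDerivative

open Summit.HodgeConjecture.HodgeConjecture.Cruxes.HLiu418.K2LiuArchOneParameterOrbitDefs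

variable {L : Type} [Field L] [NumberField L] [IsCMField L]
variable {N M n : ℕ} {e : Fin N × Fin M ≃ Fin n}
  {dV : Fin N → L} {hdV : ∀ i, IsCMField.complexConj L (dV i) = dV i}
  {dW : Fin M → L} {hdW : ∀ i, IsCMField.complexConj L (dW i) = dW i}

/-! ## 1. Derivatives along a one-parameter orbit: from `t = 0` to every `t` -/

section Orbit

variable {X : Matrix (Fin (n + n)) (Fin (n + n)) (mixedSpace L)}
  (hX : X ∈ archSkew (Fp L) L (IsCMField.complexConj L) (n + n) (hermD L e dV hdV dW hdW))

/-- **orbit shift**: if `t ↦ g(h · γ_X t)` has derivative `D h` at `t = 0` for EVERY `h ∈ H(𝔸)`, then it has derivative `D (h · γ_X t₀)` at every `t₀`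
(`γ_X (t₀ + τ) = γ_X t₀ · γ_X τ`, ★ `archExp_add`). [cite: Knapp2002, 0.§2 Prop. 0.11(c)] -/
theorem hasDerivAt_orbit_of_forall_zero {E' : Type*} [NormedAddCommGroup E'] [NormedSpace ℝ E'] (g D : HA L e dV hdV dW hdW → E')
    (hg : ∀ h : HA L e dV hdV dW hdW,
      HasDerivAt (fun t : ℝ => g (h * archExp (Fp L) L (IsCMField.complexConj L) (n + n) (hermD L e dV hdV dW hdW) hX t)) (D h) 0)
    (h : HA L e dV hdV dW hdW) (t₀ : ℝ) :
    HasDerivAt (fun t : ℝ => g (h * archExp (Fp L) L (IsCMField.complexConj L) (n + n) (hermD L e dV hdV dW hdW) hX t))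
      (D (h * archExp (Fp L) L (IsCMField.complexConj L) (n + n) (hermD L e dV hdV dW hdW) hX t₀)) t₀ := by
  set γ := archExp (Fp L) L (IsCMField.complexConj L) (n + n) (hermD L e dV hdV dW hdW) hX with hγ
  have hfun : (fun t : ℝ => g (h * γ t)) = fun t : ℝ => g (h * γ t₀ * γ (t - t₀)) := by
    funext t
    rw [mul_assoc, ← archExp_add, add_sub_cancel]
  have h0 : HasDerivAt (fun τ : ℝ => g (h * γ t₀ * γ τ)) (D (h * γ t₀)) (t₀ - t₀) := by
    rw [sub_self]
    exact hg (h * γ t₀)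
  rw [hfun]
  exact h0.comp_sub_const t₀ t₀

end Orbit

/-! ## 2. The height derivative `H` is left `P_Δ(𝔸)`-invariant; `X·φ` and `H·φ` are sections -/

section Sections

variable {𝒦 : IwasawaDatum L e dV hdV dW hdW}
variable {X : Matrix (Fin (n + n)) (Fin (n + n)) (mixedSpace L)}
  (hX : X ∈ archSkew (Fp L) L (IsCMField.complexConj L) (n + n) (hermD L e dV hdV dW hdW))

/-- **`H(p h) = H(h)` for `p ∈ P_Δ(𝔸)`**: `Φ_𝒦(p h γ_t) = modDelta p · Φ_𝒦(h γ_t)` (★ `modDelta_pPart_delta_mul`), so the two derivatives at `0`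
agree after the factor `Φ_𝒦(p h) = modDelta p · Φ_𝒦 h > 0`. [cite: Tan1999, §1 p. 166] -/
theorem heightDeriv_delta_mul (hK : 𝒦.IsDeltaUnimodular) {H : HA L e dV hdV dW hdW → ℝ}
    (hH : ∀ h : HA L e dV hdV dW hdW,
      HasDerivAt (fun t : ℝ => modDelta L e dV hdV dW hdW (𝒦.pPart (h * archExp (Fp L) L (IsCMField.complexConj L) (n + n)
        (hermD L e dV hdV dW hdW) hX t))) (modDelta L e dV hdV dW hdW (𝒦.pPart h) * H h) 0)
    {p : HA L e dV hdV dW hdW} (hp : IsSiegelDelta L e dV hdV dW hdW p) (h : HA L e dV hdV dW hdW) : H (p * h) = H h := by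
  have h1 := hH (p * h)
  have h2 : HasDerivAt (fun t : ℝ => modDelta L e dV hdV dW hdW (𝒦.pPart (p * h * archExp (Fp L) L (IsCMField.complexConj L) (n + n)
      (hermD L e dV hdV dW hdW) hX t))) (modDelta L e dV hdV dW hdW p * (modDelta L e dV hdV dW hdW (𝒦.pPart h) * H h)) 0 := by
    have h3 := (hH h).const_mul (modDelta L e dV hdV dW hdW p)
    refine h3.congr_of_eventuallyEq (Filter.Eventually.of_forall fun t => ?_)
    simp only [mul_assoc, IwasawaDatum.modDelta_pPart_delta_mul hK hp]
  have h4 := h1.unique h2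
  rw [IwasawaDatum.modDelta_pPart_delta_mul hK hp, mul_assoc] at h4
  have hpos : 0 < modDelta L e dV hdV dW hdW p * modDelta L e dV hdV dW hdW (𝒦.pPart h) :=
    mul_pos (modDelta_pos L e dV hdV dW hdW p) (modDelta_pos L e dV hdV dW hdW _)
  have h5 : modDelta L e dV hdV dW hdW p * modDelta L e dV hdV dW hdW (𝒦.pPart h) * H (p * h) =
      modDelta L e dV hdV dW hdW p * modDelta L e dV hdV dW hdW (𝒦.pPart h) * H h := by
    rw [mul_assoc, mul_assoc]; exact h4
  exact mul_left_cancel₀ hpos.ne' h5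

/-- **`X·φ ∈ I(s₀, χ)` when `φ ∈ I(s₀, χ)`**: `φ(p h γ_t) = σ_χ,s₀(p) φ(h γ_t)`, differentiate at `t = 0` and use uniqueness of derivatives.
[cite: KudlaRallis1994, §1] -/
theorem isSiegelDeltaSection_lieDeriv {χ : HeckeCharacter L} {s₀ : ℂ} {φ Xφ : HA L e dV hdV dW hdW → ℂ}
    (hφ : IsSiegelDeltaSection L e dV hdV dW hdW χ s₀ φ)
    (hXφ : ∀ h : HA L e dV hdV dW hdW,
      HasDerivAt (fun t : ℝ => φ (h * archExp (Fp L) L (IsCMField.complexConj L) (n + n) (hermD L e dV hdV dW hdW) hX t)) (Xφ h) 0) :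
    IsSiegelDeltaSection L e dV hdV dW hdW χ s₀ Xφ := by
  intro p hp h
  have h1 := hXφ (p * h)
  have h2 : HasDerivAt (fun t : ℝ => φ (p * h * archExp (Fp L) L (IsCMField.complexConj L) (n + n) (hermD L e dV hdV dW hdW) hX t))
      (siegelDeltaCharacter L e dV hdV dW hdW χ s₀ p * Xφ h) 0 := by
    refine ((hXφ h).const_mul (siegelDeltaCharacter L e dV hdV dW hdW χ s₀ p)).congr_of_eventuallyEq
      (Filter.Eventually.of_forall fun t => ?_)
    simp only [mul_assoc, hφ p hp]
  exact h1.unique h2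

/-- **`H·φ ∈ I(s₀, χ)`** for a left `P_Δ(𝔸)`-invariant real function `H` and `φ ∈ I(s₀, χ)`. [cite: KudlaRallis1994, §1] -/
theorem isSiegelDeltaSection_mul_of_delta_invariant {χ : HeckeCharacter L} {s₀ : ℂ} {φ : HA L e dV hdV dW hdW → ℂ}
    (hφ : IsSiegelDeltaSection L e dV hdV dW hdW χ s₀ φ) {H : HA L e dV hdV dW hdW → ℝ}
    (hHP : ∀ p : HA L e dV hdV dW hdW, IsSiegelDelta L e dV hdV dW hdW p → ∀ h, H (p * h) = H h) :
    IsSiegelDeltaSection L e dV hdV dW hdW χ s₀ (fun h => (H h : ℂ) * φ h) := by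
  intro p hp h
  simp only [hHP p hp h, hφ p hp h]
  ring

/-- **`H·φ ∈ I(s₀, χ)`** for the height derivative `H` and `φ ∈ I(s₀, χ)` (by `heightDeriv_delta_mul`). [cite: KudlaRallis1994, §1] [cite: Tan1999, §1] -/
theorem isSiegelDeltaSection_heightDeriv_mul (hK : 𝒦.IsDeltaUnimodular) {χ : HeckeCharacter L} {s₀ : ℂ} {φ : HA L e dV hdV dW hdW → ℂ}
    (hφ : IsSiegelDeltaSection L e dV hdV dW hdW χ s₀ φ) {H : HA L e dV hdV dW hdW → ℝ}
    (hH : ∀ h : HA L e dV hdV dW hdW,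
      HasDerivAt (fun t : ℝ => modDelta L e dV hdV dW hdW (𝒦.pPart (h * archExp (Fp L) L (IsCMField.complexConj L) (n + n)
        (hermD L e dV hdV dW hdW) hX t))) (modDelta L e dV hdV dW hdW (𝒦.pPart h) * H h) 0) :
    IsSiegelDeltaSection L e dV hdV dW hdW χ s₀ (fun h => (H h : ℂ) * φ h) :=
  isSiegelDeltaSection_mul_of_delta_invariant hφ fun _ hp h => heightDeriv_delta_mul hX hK hH hp h

end Sections

/-! ## 3. Products of `K`-finite functions -/

section KFinite

variable (𝒦 : IwasawaDatum L e dV hdV dW hdW)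

/-- the span of the right `K`-translates of a product lies in the product of the spans. [cite: HarrisKudlaSweet1996, (1.16)] -/
theorem rightTranslateSpan_mul_le (φ ψ : HA L e dV hdV dW hdW → ℂ) :
    rightTranslateSpan 𝒦 (φ * ψ) ≤ rightTranslateSpan 𝒦 φ * rightTranslateSpan 𝒦 ψ := by
  refine Submodule.span_le.2 ?_
  rintro _ ⟨k, rfl⟩
  change (fun h : HA L e dV hdV dW hdW => (φ * ψ) (h * (k : HA L e dV hdV dW hdW))) ∈ _
  have hmul : (fun h : HA L e dV hdV dW hdW => (φ * ψ) (h * (k : HA L e dV hdV dW hdW))) =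
      (fun h : HA L e dV hdV dW hdW => φ (h * (k : HA L e dV hdV dW hdW))) *
        fun h : HA L e dV hdV dW hdW => ψ (h * (k : HA L e dV hdV dW hdW)) := by
    funext h; rfl
  rw [hmul]
  exact Submodule.mul_mem_mul (rightTranslate_mem_rightTranslateSpan 𝒦 φ k.2) (rightTranslate_mem_rightTranslateSpan 𝒦 ψ k.2)

variable {𝒦}

/-- **products of `K`-finite functions are `K`-finite** (the product of two finitely generated submodules of the function algebra is finitely
generated, Mathlib `Submodule.FG.mul`). [cite: HarrisKudlaSweet1996, (1.16)] [cite: BorelJacquet1979, §4.1] -/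
theorem IsKFinite.mul {φ ψ : HA L e dV hdV dW hdW → ℂ} (hφ : IsKFinite 𝒦 φ) (hψ : IsKFinite 𝒦 ψ) : IsKFinite 𝒦 (φ * ψ) := by
  unfold IsKFinite at *
  have hfg : (rightTranslateSpan 𝒦 φ * rightTranslateSpan 𝒦 ψ).FG :=
    Submodule.FG.mul ((Submodule.fg_iff_finiteDimensional _).2 hφ) ((Submodule.fg_iff_finiteDimensional _).2 hψ)
  haveI := (Submodule.fg_iff_finiteDimensional _).1 hfg
  exact Submodule.finiteDimensional_of_le (rightTranslateSpan_mul_le 𝒦 φ ψ)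

/-- `K`-finiteness of `h ↦ H h · φ h` for a real `K`-finite `H` (read in `ℂ`) and a `K`-finite `φ`. [cite: HarrisKudlaSweet1996, (1.16)] -/
theorem IsKFinite.ofReal_mul {H : HA L e dV hdV dW hdW → ℝ} {φ : HA L e dV hdV dW hdW → ℂ}
    (hH : IsKFinite 𝒦 (fun h => (H h : ℂ))) (hφ : IsKFinite 𝒦 φ) : IsKFinite 𝒦 (fun h => (H h : ℂ) * φ h) :=
  IsKFinite.mul hH hφ

end KFinite

/-! ## 4. The derivative of the standard extension along the orbit -/

section StdExtension

variable (𝒦 : IwasawaDatum L e dV hdV dW hdW) (s₀ : ℂ)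
variable {X : Matrix (Fin (n + n)) (Fin (n + n)) (mixedSpace L)}
  (hX : X ∈ archSkew (Fp L) L (IsCMField.complexConj L) (n + n) (hermD L e dV hdV dW hdW))

/-- the complex-power factor: if `t ↦ Φ(t) > 0` has derivative `Φ(t₀) · H₀` at `t₀`, then `t ↦ (Φ t : ℂ)^c` has derivative
`c · (Φ t₀ : ℂ)^c · H₀` there. [cite: KudlaRallis1994, §1] -/
theorem hasDerivAt_ofReal_cpow_const {Φ : ℝ → ℝ} {t₀ H₀ : ℝ} (hpos : 0 < Φ t₀) (hΦ : HasDerivAt Φ (Φ t₀ * H₀) t₀) (c : ℂ) :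
    HasDerivAt (fun t : ℝ => ((Φ t : ℝ) : ℂ) ^ c) (c * ((Φ t₀ : ℝ) : ℂ) ^ c * (H₀ : ℂ)) t₀ := by
  have hne : ((Φ t₀ : ℝ) : ℂ) ≠ 0 := ofReal_ne_zero.2 hpos.ne'
  have hslit : ((Φ t₀ : ℝ) : ℂ) ∈ slitPlane := ofReal_mem_slitPlane.2 hpos
  have h1 : HasDerivAt ((fun z : ℂ => z ^ c) ∘ fun y : ℝ => ((Φ y : ℝ) : ℂ))
      (c * ((Φ t₀ : ℝ) : ℂ) ^ (c - 1) * (((Φ t₀ * H₀ : ℝ) : ℂ))) t₀ :=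
    (Complex.hasStrictDerivAt_cpow_const (c := c) hslit).hasDerivAt.comp t₀ hΦ.ofReal_comp
  have h2 : c * ((Φ t₀ : ℝ) : ℂ) ^ (c - 1) * (((Φ t₀ * H₀ : ℝ) : ℂ)) = c * ((Φ t₀ : ℝ) : ℂ) ^ c * (H₀ : ℂ) := by
    rw [cpow_sub _ _ hne, cpow_one, ofReal_mul]
    field_simp
  rw [h2] at h1
  exact h1

/-- **THE DERIVATIVE OF A STANDARD EXTENSION ALONG `h · γ_X(t)`**: with `X·φ` (`hXφ`) and the height log-derivative `H` (`hH`) BY VALUE, for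
every `s`, `h` and `t₀`,
`d/dt|_{t₀} stdExt(φ)_s(h γ_X t) = stdExt(X·φ)_s(h γ_X t₀) + 2(s − s₀) · stdExt(H·φ)_s(h γ_X t₀)`.
[cite: KudlaRallis1994, §1] [cite: Tan1999, §1 p. 166] [cite: HarrisKudlaSweet1996, (1.17)] -/
theorem hasDerivAt_stdExtension_orbit {φ Xφ : HA L e dV hdV dW hdW → ℂ} {H : HA L e dV hdV dW hdW → ℝ}
    (hXφ : ∀ h : HA L e dV hdV dW hdW,
      HasDerivAt (fun t : ℝ => φ (h * archExp (Fp L) L (IsCMField.complexConj L) (n + n) (hermD L e dV hdV dW hdW) hX t)) (Xφ h) 0)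
    (hH : ∀ h : HA L e dV hdV dW hdW,
      HasDerivAt (fun t : ℝ => modDelta L e dV hdV dW hdW (𝒦.pPart (h * archExp (Fp L) L (IsCMField.complexConj L) (n + n)
        (hermD L e dV hdV dW hdW) hX t))) (modDelta L e dV hdV dW hdW (𝒦.pPart h) * H h) 0)
    (s : ℂ) (h : HA L e dV hdV dW hdW) (t₀ : ℝ) :
    HasDerivAt (fun t : ℝ => stdExtension 𝒦 s₀ φ s (h * archExp (Fp L) L (IsCMField.complexConj L) (n + n) (hermD L e dV hdV dW hdW) hX t))
      (stdExtension 𝒦 s₀ Xφ s (h * archExp (Fp L) L (IsCMField.complexConj L) (n + n) (hermD L e dV hdV dW hdW) hX t₀) +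
        2 * (s - s₀) * stdExtension 𝒦 s₀ (fun x => (H x : ℂ) * φ x) s
          (h * archExp (Fp L) L (IsCMField.complexConj L) (n + n) (hermD L e dV hdV dW hdW) hX t₀)) t₀ := by
  set γ := archExp (Fp L) L (IsCMField.complexConj L) (n + n) (hermD L e dV hdV dW hdW) hX with hγ
  -- the two inputs, moved from `0` to `t₀`
  have hφ' : HasDerivAt (fun t : ℝ => φ (h * γ t)) (Xφ (h * γ t₀)) t₀ :=
    hasDerivAt_orbit_of_forall_zero hX φ Xφ hXφ h t₀
  have hΦ' : HasDerivAt (fun t : ℝ => modDelta L e dV hdV dW hdW (𝒦.pPart (h * γ t)))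
      (modDelta L e dV hdV dW hdW (𝒦.pPart (h * γ t₀)) * H (h * γ t₀)) t₀ :=
    hasDerivAt_orbit_of_forall_zero hX (fun x => modDelta L e dV hdV dW hdW (𝒦.pPart x))
      (fun x => modDelta L e dV hdV dW hdW (𝒦.pPart x) * H x) hH h t₀
  -- the complex power of the height
  have hpow := hasDerivAt_ofReal_cpow_const (Φ := fun t => modDelta L e dV hdV dW hdW (𝒦.pPart (h * γ t)))
    (modDelta_pos L e dV hdV dW hdW _) hΦ' (2 * (s - s₀))
  -- product rule
  have hprod := hpow.mul hφ'
  refine hprod.congr_deriv ?_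
  simp only [stdExtension]
  ring

/-- the same derivative at `t₀ = 0` (`γ_X 0 = 1`). [cite: KudlaRallis1994, §1] -/
theorem hasDerivAt_stdExtension_orbit_zero {φ Xφ : HA L e dV hdV dW hdW → ℂ} {H : HA L e dV hdV dW hdW → ℝ}
    (hXφ : ∀ h : HA L e dV hdV dW hdW,
      HasDerivAt (fun t : ℝ => φ (h * archExp (Fp L) L (IsCMField.complexConj L) (n + n) (hermD L e dV hdV dW hdW) hX t)) (Xφ h) 0)
    (hH : ∀ h : HA L e dV hdV dW hdW,
      HasDerivAt (fun t : ℝ => modDelta L e dV hdV dW hdW (𝒦.pPart (h * archExp (Fp L) L (IsCMField.complexConj L) (n + n)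
        (hermD L e dV hdV dW hdW) hX t))) (modDelta L e dV hdV dW hdW (𝒦.pPart h) * H h) 0)
    (s : ℂ) (h : HA L e dV hdV dW hdW) :
    HasDerivAt (fun t : ℝ => stdExtension 𝒦 s₀ φ s (h * archExp (Fp L) L (IsCMField.complexConj L) (n + n) (hermD L e dV hdV dW hdW) hX t))
      (stdExtension 𝒦 s₀ Xφ s h + 2 * (s - s₀) * stdExtension 𝒦 s₀ (fun x => (H x : ℂ) * φ x) s h) 0 := by
  simpa only [archExp_zero, mul_one] using hasDerivAt_stdExtension_orbit 𝒦 s₀ hX hXφ hH s h 0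

/-! ## 5. Both output families are standard: the flat-vs-translate identity of §G1.1 -/

/-- **`stdExt(X·φ)` is a standard family** when `φ ∈ I(s₀, χ)` and `X·φ` is `K`-finite (its section property is derived, `isSiegelDeltaSection_lieDeriv`).
[cite: KudlaRallis1994, §1] [cite: Tan1999, §1 p. 166] -/
theorem isStandardSectionFamily_lieDeriv (hK : 𝒦.IsDeltaUnimodular) {χ : HeckeCharacter L} {φ Xφ : HA L e dV hdV dW hdW → ℂ}
    (hφ : IsSiegelDeltaSection L e dV hdV dW hdW χ s₀ φ)
    (hXφ : ∀ h : HA L e dV hdV dW hdW,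
      HasDerivAt (fun t : ℝ => φ (h * archExp (Fp L) L (IsCMField.complexConj L) (n + n) (hermD L e dV hdV dW hdW) hX t)) (Xφ h) 0)
    (hXφK : IsKFinite 𝒦 Xφ) : IsStandardSectionFamily 𝒦 χ (stdExtension 𝒦 s₀ Xφ) :=
  isStandardSectionFamily_stdExtension hK (isSiegelDeltaSection_lieDeriv hX hφ hXφ) hXφK

/-- **`stdExt(H·φ)` is a standard family** when `φ ∈ I(s₀, χ)` is `K`-finite and the height log-derivative `H` is `K`-finite
(`hHK`, by value; its left `P_Δ`-invariance is derived). [cite: KudlaRallis1994, §1] [cite: Tan1999, §1 p. 166] -/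
theorem isStandardSectionFamily_heightDeriv_mul (hK : 𝒦.IsDeltaUnimodular) {χ : HeckeCharacter L} {φ : HA L e dV hdV dW hdW → ℂ}
    {H : HA L e dV hdV dW hdW → ℝ} (hφ : IsSiegelDeltaSection L e dV hdV dW hdW χ s₀ φ) (hφK : IsKFinite 𝒦 φ)
    (hH : ∀ h : HA L e dV hdV dW hdW,
      HasDerivAt (fun t : ℝ => modDelta L e dV hdV dW hdW (𝒦.pPart (h * archExp (Fp L) L (IsCMField.complexConj L) (n + n)
        (hermD L e dV hdV dW hdW) hX t))) (modDelta L e dV hdV dW hdW (𝒦.pPart h) * H h) 0)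
    (hHK : IsKFinite 𝒦 (fun h => (H h : ℂ))) :
    IsStandardSectionFamily 𝒦 χ (stdExtension 𝒦 s₀ (fun h => (H h : ℂ) * φ h)) :=
  isStandardSectionFamily_stdExtension hK (isSiegelDeltaSection_heightDeriv_mul hX hK hφ hH) (IsKFinite.ofReal_mul hHK hφK)

/-- **THE FLAT-vs-TRANSLATE IDENTITY (SIGS-RoadI-v3 §G1.1, one term)**: along `h · γ_X(t)` the standard family `f = stdExt(φ)` differentiates into
finitely many STANDARD families with polynomial coefficients — `d/dt|_{t₀} f_s(h γ_X t) = (f₁ s + (2(s − s₀)) • f₂ s)(h γ_X t₀)` with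
`f₁ = stdExt(X·φ)`, `f₂ = stdExt(H·φ)` both standard. [cite: KudlaRallis1994, §1] [cite: Tan1999, §1 p. 166] [cite: HarrisKudlaSweet1996, (1.17)] -/
theorem exists_standard_lieDeriv_stdExtension (hK : 𝒦.IsDeltaUnimodular) {χ : HeckeCharacter L} {φ Xφ : HA L e dV hdV dW hdW → ℂ}
    {H : HA L e dV hdV dW hdW → ℝ} (hφ : IsSiegelDeltaSection L e dV hdV dW hdW χ s₀ φ) (hφK : IsKFinite 𝒦 φ)
    (hXφ : ∀ h : HA L e dV hdV dW hdW,
      HasDerivAt (fun t : ℝ => φ (h * archExp (Fp L) L (IsCMField.complexConj L) (n + n) (hermD L e dV hdV dW hdW) hX t)) (Xφ h) 0)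
    (hXφK : IsKFinite 𝒦 Xφ)
    (hH : ∀ h : HA L e dV hdV dW hdW,
      HasDerivAt (fun t : ℝ => modDelta L e dV hdV dW hdW (𝒦.pPart (h * archExp (Fp L) L (IsCMField.complexConj L) (n + n)
        (hermD L e dV hdV dW hdW) hX t))) (modDelta L e dV hdV dW hdW (𝒦.pPart h) * H h) 0)
    (hHK : IsKFinite 𝒦 (fun h => (H h : ℂ))) :
    ∃ f₁ f₂ : ℂ → HA L e dV hdV dW hdW → ℂ,
      IsStandardSectionFamily 𝒦 χ f₁ ∧ IsStandardSectionFamily 𝒦 χ f₂ ∧ f₁ s₀ = Xφ ∧ f₂ s₀ = (fun h => (H h : ℂ) * φ h) ∧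
        ∀ (s : ℂ) (h : HA L e dV hdV dW hdW) (t₀ : ℝ),
          HasDerivAt
            (fun t : ℝ => stdExtension 𝒦 s₀ φ s (h * archExp (Fp L) L (IsCMField.complexConj L) (n + n) (hermD L e dV hdV dW hdW) hX t))
            (f₁ s (h * archExp (Fp L) L (IsCMField.complexConj L) (n + n) (hermD L e dV hdV dW hdW) hX t₀) +
              2 * (s - s₀) * f₂ s (h * archExp (Fp L) L (IsCMField.complexConj L) (n + n) (hermD L e dV hdV dW hdW) hX t₀)) t₀ :=
  ⟨stdExtension 𝒦 s₀ Xφ, stdExtension 𝒦 s₀ (fun h => (H h : ℂ) * φ h),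
    isStandardSectionFamily_lieDeriv 𝒦 s₀ hX hK hφ hXφ hXφK, isStandardSectionFamily_heightDeriv_mul 𝒦 s₀ hX hK hφ hφK hH hHK,
    stdExtension_self 𝒦 s₀ Xφ, stdExtension_self 𝒦 s₀ _,
    fun s h t₀ => hasDerivAt_stdExtension_orbit 𝒦 s₀ hX hXφ hH s h t₀⟩

end StdExtension

end Summit.HodgeConjecture.HodgeConjecture.Cruxes.HLiu418.K2LiuFlatSectionLieDerivative
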